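import Summits.Parity.BatemanHorn.Theses.IsogenyRedei
import Literature.NumberTheory.EllipticCurves.TwoIsogenySelmerGroupProofs
import HarnessLib

/-!
# Route IsogenyRedei, crux `PencilSelmerDictionary` (stmt-Parity-11584): glue of line `toric-node-vacuity-cassels`

Crux: `∃ M, ∃ w : ℕ → ℤ, (∀ t, w (t + 2^M) = w t) ∧ ∀ t ≥ 1, (-1)^{corank_{ℤ₂} Sel_{2^∞}(E_t/ℚ)} =
-(w t · (-1)^{#odd p ∣ t²+1})`, `E_t = ⟨0, 2t, 0, t²+1, 0⟩`. The line computes the two EXPLICIT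
`2`-isogeny Selmer sets of the pencil (`twoIsogenySelmerGroup`, Silverman *AEC* X.4.9) place by place —
five local/elementary statements A (odd places, `b`-side: vacuous), B (odd places, dual side: `2` is a
square mod `p ∣ t²+1`), C, D (the 2-adic tables), E (divisor count), each landed in its own sibling
file `Theorems/IsogenyRedeiPencilSelmerDictionary*.lean` — and crosses to the `2^∞`-Selmer corank with
Cassels' formula for the `2`-isogeny in parity form, the tree's NAMED FACT
`Literature.NumberTheory.EllipticCurves.cassels_selmerCorank_two_parity` (statement F). This file is
the sorry-free COMPOSITION with the six statements as hypotheses: `dictionary_of_localData` (A–F on the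
pencil ⇒ the pointwise identity with the sharp period-4 factor `w t = if t % 4 < 2 then -1 else 1`),
`casselsPencil_of_fact` (F on the pencil is the named fact at `(a, b) = (2t, t²+1)`); the sibling file
`IsogenyRedeiPencilSelmerDictionary.lean` feeds in the landed A–E and concludes the crux BY NAME. Conditional
(D-0014) only through the named fact. Skeleton by planner-cruxplan-stmt-Parity-11584-toric-node-vacuity-c-0
(crux workfile `Lines/toric-node-vacuity-cassels.lean`); no definitions, no new named facts.

References: Silverman, *AEC* (2009), X.4.9 [cite: SilvermanAEC2009, Prop. X.4.9]; Dokchitser–Dokchitser,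
J. reine angew. Math. 658 (2011), §5 "Cassels' formula" [cite: DokchitserDokchitser2011Crelle, §5].
-/

noncomputable section

open scoped Classical

namespace Summit.Parity.BatemanHorn.Theorems.PencilSelmerDictionary

open Literature.NumberTheory.EllipticCurves
open Summit.Parity.BatemanHorn.Theses.IsogenyRedei (PencilSelmerDictionary)

/-! ## Stub F is the named fact restricted to the pencil (proved reduction) -/

/-- `b (a² − 4b) ≠ 0` for `(a, b) = (2t, t²+1)`: it is `−4 (t²+1)`. -/
theorem pencil_ne_zero (t : ℕ) :
    ((t : ℤ) ^ 2 + 1) * ((2 * (t : ℤ)) ^ 2 - 4 * ((t : ℤ) ^ 2 + 1)) ≠ 0 := by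
  have e : (2 * (t : ℤ)) ^ 2 - 4 * ((t : ℤ) ^ 2 + 1) = -4 := by ring
  rw [e]
  exact mul_ne_zero (by positivity) (by norm_num)

/-- Stub F follows in one line from the tree's named fact `cassels_selmerCorank_two_parity`. -/
theorem casselsPencil_of_fact (h : cassels_selmerCorank_two_parity) :
    ∀ t : ℕ, 1 ≤ t →
      (-1 : ℤ) ^ (⟨0, 2 * (t : ℚ), 0, (t : ℚ) ^ 2 + 1, 0⟩ : WeierstrassCurve ℚ).selmerCorank 2 =
        (-1 : ℤ) ^ (twoIsogenySelmerRank (2 * (t : ℤ)) ((t : ℤ) ^ 2 + 1) +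
          twoIsogenySelmerRank' (2 * (t : ℤ)) ((t : ℤ) ^ 2 + 1)) := by
  intro t _
  have key := h (2 * (t : ℤ)) ((t : ℤ) ^ 2 + 1) (pencil_ne_zero t)
  push_cast at key
  exact key

/-! ## Proved helpers -/

/-- The real place on the `b`-side: for `d < 0` (hence `d′ = (t²+1)/d < 0`) the form
`d u⁴ + 2t u²z² + d′ z⁴` is negative definite (`d · q = (d u² + t z²)² + z⁴`), so `w² = q` has no real
point. (The tree's `not_isSoluble_real_twoIsogenyQuartic_of_neg` needs `a ≤ 0` and does not apply —
triage r1-2 sharpening.) -/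
theorem real_obstruction (t : ℕ) {d : ℤ} (hd : d < 0) (hdvd : d ∣ (t : ℤ) ^ 2 + 1) :
    ¬ ((twoIsogenyQuartic (2 * (t : ℤ)) d (((t : ℤ) ^ 2 + 1) / d)).map
        (Int.castRingHom ℝ)).IsSoluble := by
  rintro ⟨u, z, w, h0, h⟩
  have hdd' : d * (((t : ℤ) ^ 2 + 1) / d) = (t : ℤ) ^ 2 + 1 := Int.mul_ediv_cancel' hdvd
  rw [eval_map_twoIsogenyQuartic] at h
  simp only [eq_intCast] at h
  push_cast at h
  have hdd'R : (d : ℝ) * ((((t : ℤ) ^ 2 + 1) / d : ℤ) : ℝ) = (t : ℝ) ^ 2 + 1 := by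
    exact_mod_cast hdd'
  have hdR : (d : ℝ) < 0 := by exact_mod_cast hd
  have key : (d : ℝ) * w ^ 2 = ((d : ℝ) * u ^ 2 + (t : ℝ) * z ^ 2) ^ 2 + z ^ 4 := by
    rw [h]
    linear_combination (z ^ 4) * hdd'R
  have hneg : (d : ℝ) * w ^ 2 ≤ 0 := mul_nonpos_of_nonpos_of_nonneg hdR.le (sq_nonneg w)
  have hz : z = 0 := by
    by_contra hz
    have hz4 : 0 < z ^ 4 := Even.pow_pos ⟨2, rfl⟩ hz
    nlinarith [sq_nonneg ((d : ℝ) * u ^ 2 + (t : ℝ) * z ^ 2)]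
  subst hz
  have hu : u = 0 := by
    by_contra hu
    have hu4 : 0 < u ^ 4 := Even.pow_pos ⟨2, rfl⟩ hu
    have hd2 : 0 < (d : ℝ) * d := mul_pos_of_neg_of_neg hdR hdR
    nlinarith [mul_pos hd2 hu4]
  subst hu
  rcases h0 with h0 | h0 <;> exact h0 rfl

/-- An odd prime factor of `t² + 1` is `≡ 1 (mod 4)` (`−1 ≡ t²` is a square mod `p`). -/
theorem mod_four_of_dvd (t : ℕ) {p : ℕ} (hp : p.Prime) (hp2 : p ≠ 2) (hdvd : p ∣ t ^ 2 + 1) :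
    p % 4 = 1 := by
  haveI := Fact.mk hp
  have hsq : IsSquare (-1 : ZMod p) := by
    refine ⟨(t : ZMod p), ?_⟩
    have h0 : ((t ^ 2 + 1 : ℕ) : ZMod p) = 0 := (ZMod.natCast_eq_zero_iff _ _).mpr hdvd
    push_cast at h0
    linear_combination -h0
  have h4 := ZMod.exists_sq_eq_neg_one_iff.mp hsq
  rcases hp.eq_two_or_odd with h | h
  · exact absurd h hp2
  · omega

/-- `4` is not squarefree in `ℤ`. -/
theorem not_squarefree_four : ¬ Squarefree (4 : ℤ) := fun h => by
  have h2 := h 2 ⟨1, by norm_num⟩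
  rw [Int.isUnit_iff] at h2
  omega

/-- `−4` is not squarefree in `ℤ`. -/
theorem not_squarefree_neg_four : ¬ Squarefree (-4 : ℤ) := fun h => by
  have h2 := h 2 ⟨-1, by norm_num⟩
  rw [Int.isUnit_iff] at h2
  omega

/-- Powers of `−1` only see the exponent mod `2`. -/
theorem neg_one_pow_congr {m n : ℕ} (h : m % 2 = n % 2) : (-1 : ℤ) ^ m = (-1 : ℤ) ^ n := by
  rw [neg_one_pow_eq_pow_mod_two (R := ℤ) (n := m), h, ← neg_one_pow_eq_pow_mod_two]

/-! ## The composition: local data + count + Cassels ⇒ the pointwise dictionary -/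

/-- **The glue, fully proved.** Hypotheses = the six stub statements verbatim; conclusion = the crux
identity at `t` with the sharp periodic factor `w t = if t % 4 < 2 then −1 else 1`.
Steps: `S(2t, t²+1) = {d ∈ [1, t²+1] : squarefree, d ∣ t²+1, table}` (real obstruction + Stubs A, C),
hence `dim S = ω − r` (Stub E, `Nat.log_pow`); `S′ = S(−4t, −4) ⊆ {±1, ±2}` contains `±1`
(images of `O`, `T′`), and `2 ∈ S′ ↔ −2 ∈ S′` (translation by the class `−1`, tree
`isSoluble_map_twoIsogenyQuartic_of_mul_eq`) `↔ (t ≡ 0 (4) ∨ t ≡ 7 (8)) ∧ ¬β` (Stubs B, D), hence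
`dim S′ ∈ {1, 2}`; Stub F; a parity check on `t mod 8 × β`. -/
theorem dictionary_of_localData :
    ∀
    (hA : ∀ t : ℕ, 1 ≤ t → ∀ d : ℤ, 0 < d → Squarefree d → d ∣ (t : ℤ) ^ 2 + 1 →
      ∀ (p : ℕ) [Fact p.Prime], p ≠ 2 →
        ((twoIsogenyQuartic (2 * (t : ℤ)) d (((t : ℤ) ^ 2 + 1) / d)).map
          (Int.castRingHom ℚ_[p])).IsSoluble)
    (hB : ∀ t : ℕ, 1 ≤ t → ∀ (p : ℕ) [Fact p.Prime], p ≠ 2 →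
      (((twoIsogenyQuartic (-4 * (t : ℤ)) 2 (-2)).map (Int.castRingHom ℚ_[p])).IsSoluble ↔
        (p ∣ t ^ 2 + 1 → p % 8 = 1)))
    (hC : ∀ t : ℕ, 1 ≤ t → ∀ d : ℤ, 0 < d → Squarefree d → d ∣ (t : ℤ) ^ 2 + 1 →
      (((twoIsogenyQuartic (2 * (t : ℤ)) d (((t : ℤ) ^ 2 + 1) / d)).map
          (Int.castRingHom ℚ_[2])).IsSoluble ↔
        ((d % 2 = 1 ∧ (d % 8 = 1 ∨ (d % 8 = 5 ∧ (t % 4 = 1 ∨ t % 4 = 2)))) ∨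
          (d % 2 = 0 ∧ ((d / 2 % 8 = 1 ∧ (t % 4 = 1 ∨ t % 8 = 7)) ∨
            (d / 2 % 8 = 5 ∧ (t % 4 = 1 ∨ t % 8 = 3)))))))
    (hD : ∀ t : ℕ, 1 ≤ t →
      (((twoIsogenyQuartic (-4 * (t : ℤ)) 2 (-2)).map (Int.castRingHom ℚ_[2])).IsSoluble ↔
        (t % 4 = 0 ∨ t % 8 = 7)))
    (hE : ∀ t : ℕ, 1 ≤ t →
      ((Finset.Icc (1 : ℤ) ((t : ℤ) ^ 2 + 1)).filter (fun d : ℤ =>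
          Squarefree d ∧ d ∣ (t : ℤ) ^ 2 + 1 ∧
            ((d % 2 = 1 ∧ (d % 8 = 1 ∨ (d % 8 = 5 ∧ (t % 4 = 1 ∨ t % 4 = 2)))) ∨
              (d % 2 = 0 ∧ ((d / 2 % 8 = 1 ∧ (t % 4 = 1 ∨ t % 8 = 7)) ∨
                (d / 2 % 8 = 5 ∧ (t % 4 = 1 ∨ t % 8 = 3))))))).card =
        2 ^ ((t ^ 2 + 1).primeFactors.card -
          (if t % 8 = 3 ∨ ((t % 4 = 0 ∨ t % 8 = 7) ∧ ∃ p ∈ (t ^ 2 + 1).primeFactors, p % 8 = 5)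
            then 1 else 0)))
    (hF : ∀ t : ℕ, 1 ≤ t →
      (-1 : ℤ) ^ (⟨0, 2 * (t : ℚ), 0, (t : ℚ) ^ 2 + 1, 0⟩ : WeierstrassCurve ℚ).selmerCorank 2 =
        (-1 : ℤ) ^ (twoIsogenySelmerRank (2 * (t : ℤ)) ((t : ℤ) ^ 2 + 1) +
          twoIsogenySelmerRank' (2 * (t : ℤ)) ((t : ℤ) ^ 2 + 1)))
    (t : ℕ) (ht : 1 ≤ t),
    (-1 : ℤ) ^ (⟨0, 2 * (t : ℚ), 0, (t : ℚ) ^ 2 + 1, 0⟩ : WeierstrassCurve ℚ).selmerCorank 2 =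
      -((if t % 4 < 2 then (-1 : ℤ) else 1) *
        (-1 : ℤ) ^ (((t ^ 2 + 1).primeFactors.filter (fun p : ℕ => p ≠ 2)).card)) := by
  intro hA hB hC hD hE hF t ht
  have hb0 : (0 : ℤ) < (t : ℤ) ^ 2 + 1 := by positivity
  have hbne : (t : ℤ) ^ 2 + 1 ≠ 0 := hb0.ne'
  -- `b`-side: the Selmer set is the explicit filter, so its dimension is `ω − r`
  have hS : twoIsogenySelmerGroup (2 * (t : ℤ)) ((t : ℤ) ^ 2 + 1) =
      (Finset.Icc (1 : ℤ) ((t : ℤ) ^ 2 + 1)).filter (fun d : ℤ =>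
          Squarefree d ∧ d ∣ (t : ℤ) ^ 2 + 1 ∧
            ((d % 2 = 1 ∧ (d % 8 = 1 ∨ (d % 8 = 5 ∧ (t % 4 = 1 ∨ t % 4 = 2)))) ∨
              (d % 2 = 0 ∧ ((d / 2 % 8 = 1 ∧ (t % 4 = 1 ∨ t % 8 = 7)) ∨
                (d / 2 % 8 = 5 ∧ (t % 4 = 1 ∨ t % 8 = 3)))))) := by
    ext d
    simp only [Finset.mem_filter, Finset.mem_Icc]
    constructor
    · intro hd
      obtain ⟨hsq, hdvd, hR, hP⟩ := (mem_twoIsogenySelmerGroup_iff hbne).mp hd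
      have hdpos : 0 < d := by
        rcases lt_or_gt_of_ne hsq.ne_zero with hneg | hpos
        · exact absurd hR (real_obstruction t hneg hdvd)
        · exact hpos
      exact ⟨⟨hdpos, Int.le_of_dvd hb0 hdvd⟩, hsq, hdvd, (hC t ht d hdpos hsq hdvd).mp (hP 2)⟩
    · rintro ⟨⟨hd1, -⟩, hsq, hdvd, htab⟩
      have hdpos : 0 < d := by omega
      rw [mem_twoIsogenySelmerGroup_iff_of_pos hbne hdpos]
      refine ⟨hsq, hdvd, fun p hp => ?_⟩
      by_cases hp2 : p = 2
      · subst hp2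
        exact (hC t ht d hdpos hsq hdvd).mpr htab
      · exact hA t ht d hdpos hsq hdvd p hp2
  have hrank : twoIsogenySelmerRank (2 * (t : ℤ)) ((t : ℤ) ^ 2 + 1) =
      (t ^ 2 + 1).primeFactors.card -
        (if t % 8 = 3 ∨ ((t % 4 = 0 ∨ t % 8 = 7) ∧ ∃ p ∈ (t ^ 2 + 1).primeFactors, p % 8 = 5)
          then 1 else 0) := by
    rw [twoIsogenySelmerRank, hS, hE t ht, Nat.log_pow Nat.one_lt_two]
  -- dual side: `S′ = S(−4t, −4) ∈ { {±1}, {±1, ±2} }`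
  have h4ne : (-4 : ℤ) ≠ 0 := by norm_num
  have hab' : (-4 : ℤ) * ((-4 * (t : ℤ)) ^ 2 - 4 * (-4)) ≠ 0 := by
    have e : (-4 * (t : ℤ)) ^ 2 - 4 * (-4) = 16 * ((t : ℤ) ^ 2 + 1) := by ring
    rw [e]
    exact mul_ne_zero h4ne (mul_ne_zero (by norm_num) hbne)
  have hS'eq : twoIsogenySelmerGroup' (2 * (t : ℤ)) ((t : ℤ) ^ 2 + 1) =
      twoIsogenySelmerGroup (-4 * (t : ℤ)) (-4) := by
    rw [twoIsogenySelmerGroup'_eq]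
    congr 1 <;> ring
  have h1 : (1 : ℤ) ∈ twoIsogenySelmerGroup (-4 * (t : ℤ)) (-4) :=
    one_mem_twoIsogenySelmerGroup _ h4ne
  have hm1 : (-1 : ℤ) ∈ twoIsogenySelmerGroup (-4 * (t : ℤ)) (-4) :=
    mem_twoIsogenySelmerGroup_of_isSquare h4ne isUnit_one.neg.squarefree (by norm_num)
      ⟨2, by norm_num⟩
  have hsub : ∀ d ∈ twoIsogenySelmerGroup (-4 * (t : ℤ)) (-4),
      d = -2 ∨ d = -1 ∨ d = 1 ∨ d = 2 := by
    intro d hd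
    have hsq := squarefree_of_mem_twoIsogenySelmerGroup hd
    have hdvd : d ∣ 4 := dvd_neg.mp (dvd_of_mem_twoIsogenySelmerGroup hd)
    have hle : d ≤ 4 := Int.le_of_dvd (by norm_num) hdvd
    have hge : -4 ≤ d := by
      have := Int.le_of_dvd (by norm_num) (neg_dvd.mpr hdvd)
      omega
    have h0 := hsq.ne_zero
    interval_cases d
    · exact absurd hsq not_squarefree_neg_four
    · exfalso; norm_num at hdvd
    · exact Or.inl rfl
    · exact Or.inr (Or.inl rfl)
    · exact absurd rfl h0
    · exact Or.inr (Or.inr (Or.inl rfl))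
    · exact Or.inr (Or.inr (Or.inr rfl))
    · exfalso; norm_num at hdvd
    · exact absurd hsq not_squarefree_four
  -- the class `−1` is soluble everywhere (`(−4)/(−1) = 2²`: the point `(0:1:2)`)
  have e41 : (-4 : ℤ) / -1 = 2 ^ 2 := by norm_num
  have hm1F : ∀ (F : Type) [Field F],
      ((twoIsogenyQuartic (-4 * (t : ℤ)) (-1) ((-4) / (-1))).map (Int.castRingHom F)).IsSoluble := by
    intro F _
    rw [e41]
    exact isSoluble_map_twoIsogenyQuartic_of_sq_right _ _ _ _
  have hneg2 : (-2 : ℤ) ∈ twoIsogenySelmerGroup (-4 * (t : ℤ)) (-4) ↔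
      (2 : ℤ) ∈ twoIsogenySelmerGroup (-4 * (t : ℤ)) (-4) := by
    rw [mem_twoIsogenySelmerGroup_iff h4ne, mem_twoIsogenySelmerGroup_iff h4ne]
    constructor
    · rintro ⟨-, -, hR, hP⟩
      refine ⟨Int.prime_two.squarefree, by norm_num, ?_, fun p hp => ?_⟩
      · exact isSoluble_map_twoIsogenyQuartic_of_mul_eq hab' (d₁ := -1) (d₂ := -2) (d₃ := 2)
          (m := 1) (by norm_num) (by norm_num) (by norm_num) (by norm_num) (hm1F ℝ) hR
      · exact isSoluble_map_twoIsogenyQuartic_of_mul_eq hab' (d₁ := -1) (d₂ := -2) (d₃ := 2)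
          (m := 1) (by norm_num) (by norm_num) (by norm_num) (by norm_num) (hm1F ℚ_[p]) (hP p)
    · rintro ⟨-, -, hR, hP⟩
      refine ⟨Int.prime_two.neg.squarefree, by norm_num, ?_, fun p hp => ?_⟩
      · exact isSoluble_map_twoIsogenyQuartic_of_mul_eq hab' (d₁ := -1) (d₂ := 2) (d₃ := -2)
          (m := 1) (by norm_num) (by norm_num) (by norm_num) (by norm_num) (hm1F ℝ) hR
      · exact isSoluble_map_twoIsogenyQuartic_of_mul_eq hab' (d₁ := -1) (d₂ := 2) (d₃ := -2)
          (m := 1) (by norm_num) (by norm_num) (by norm_num) (by norm_num) (hm1F ℚ_[p]) (hP p)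
  -- the class `2`: Stubs B (odd places) and D (the place 2); the real place is free (`2 > 0`)
  have h2iff : (2 : ℤ) ∈ twoIsogenySelmerGroup (-4 * (t : ℤ)) (-4) ↔
      ((t % 4 = 0 ∨ t % 8 = 7) ∧ ¬ ∃ p ∈ (t ^ 2 + 1).primeFactors, p % 8 = 5) := by
    rw [mem_twoIsogenySelmerGroup_iff_of_pos h4ne (by norm_num : (0 : ℤ) < 2)]
    have e42 : (-4 : ℤ) / 2 = -2 := by norm_num
    rw [e42]
    constructor
    · rintro ⟨-, -, hloc⟩
      refine ⟨(hD t ht).mp (hloc 2), ?_⟩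
      rintro ⟨p, hp, hp5⟩
      obtain ⟨hpp, hpdvd, -⟩ := Nat.mem_primeFactors.mp hp
      have hp2 : p ≠ 2 := by omega
      haveI : Fact p.Prime := ⟨hpp⟩
      have h81 := (hB t ht p hp2).mp (hloc p) hpdvd
      omega
    · rintro ⟨h2, hB5⟩
      refine ⟨Int.prime_two.squarefree, by norm_num, fun p hp => ?_⟩
      by_cases hp2 : p = 2
      · subst hp2
        exact (hD t ht).mpr h2
      · refine (hB t ht p hp2).mpr fun hpdvd => ?_
        have h41 := mod_four_of_dvd t hp.out hp2 hpdvd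
        by_contra h81
        exact hB5 ⟨p, Nat.mem_primeFactors.mpr ⟨hp.out, hpdvd, by positivity⟩, by omega⟩
  have hcardT : (twoIsogenySelmerGroup (-4 * (t : ℤ)) (-4)).card =
      if (2 : ℤ) ∈ twoIsogenySelmerGroup (-4 * (t : ℤ)) (-4) then 4 else 2 := by
    split_ifs with h2
    · have hT : twoIsogenySelmerGroup (-4 * (t : ℤ)) (-4) = {-2, -1, 1, 2} := by
        ext d
        simp only [Finset.mem_insert, Finset.mem_singleton]
        refine ⟨hsub d, fun h => ?_⟩
        rcases h with rfl | rfl | rfl | rfl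
        · exact hneg2.mpr h2
        · exact hm1
        · exact h1
        · exact h2
      rw [hT]
      decide
    · have hT : twoIsogenySelmerGroup (-4 * (t : ℤ)) (-4) = {-1, 1} := by
        ext d
        simp only [Finset.mem_insert, Finset.mem_singleton]
        refine ⟨fun hd => ?_, fun h => ?_⟩
        · rcases hsub d hd with rfl | rfl | rfl | rfl
          · exact absurd (hneg2.mp hd) h2
          · exact Or.inl rfl
          · exact Or.inr rfl
          · exact absurd hd h2
        · rcases h with rfl | rfl
          · exact hm1
          · exact h1
      rw [hT]
      decide
  have hrank' : twoIsogenySelmerRank' (2 * (t : ℤ)) ((t : ℤ) ^ 2 + 1) =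
      if (2 : ℤ) ∈ twoIsogenySelmerGroup (-4 * (t : ℤ)) (-4) then 2 else 1 := by
    rw [twoIsogenySelmerRank'_eq, hS'eq, hcardT]
    split_ifs
    · exact Nat.log_eq_of_pow_le_of_lt_pow (by norm_num) (by norm_num)
    · exact Nat.log_eq_of_pow_le_of_lt_pow (by norm_num) (by norm_num)
  -- `ω` versus `ω_odd`, and `ω ≥ 1`
  have h2mem : 2 ∈ (t ^ 2 + 1).primeFactors ↔ t % 2 = 1 := by
    rw [Nat.mem_primeFactors]
    constructor
    · rintro ⟨-, ⟨k, hk⟩, -⟩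
      by_contra hev
      obtain ⟨m, hm⟩ : 2 ∣ t := Nat.dvd_of_mod_eq_zero (by omega)
      have : t ^ 2 = 2 * (2 * m ^ 2) := by rw [hm]; ring
      omega
    · intro hodd
      refine ⟨Nat.prime_two, ?_, by positivity⟩
      obtain ⟨k, hk⟩ : ∃ k, t = 2 * k + 1 := ⟨t / 2, by omega⟩
      exact ⟨2 * k ^ 2 + 2 * k + 1, by rw [hk]; ring⟩
  have hfilt : (t ^ 2 + 1).primeFactors.filter (fun p : ℕ => p ≠ 2) =
      (t ^ 2 + 1).primeFactors.erase 2 := by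
    ext p
    simp only [Finset.mem_filter, Finset.mem_erase]
    exact and_comm
  have hω1 : 1 ≤ (t ^ 2 + 1).primeFactors.card := by
    have h1t : 1 ≤ t ^ 2 := Nat.one_le_pow _ _ ht
    exact Finset.card_pos.mpr (Nat.nonempty_primeFactors.mpr (by omega))
  have hωodd : t % 2 = 1 →
      ((t ^ 2 + 1).primeFactors.filter (fun p : ℕ => p ≠ 2)).card + 1 =
        (t ^ 2 + 1).primeFactors.card := by
    intro hodd
    rw [hfilt, Finset.card_erase_of_mem (h2mem.mpr hodd)]
    omega
  have hωeven : t % 2 = 0 →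
      ((t ^ 2 + 1).primeFactors.filter (fun p : ℕ => p ≠ 2)).card =
        (t ^ 2 + 1).primeFactors.card := by
    intro hev
    rw [hfilt, Finset.erase_eq_of_notMem]
    intro h
    have := h2mem.mp h
    omega
  -- assemble: Cassels + the two dimensions, then a parity check on `t mod 8 × β`
  have rhs_eq : -((if t % 4 < 2 then (-1 : ℤ) else 1) *
        (-1 : ℤ) ^ (((t ^ 2 + 1).primeFactors.filter (fun p : ℕ => p ≠ 2)).card)) =
      (-1 : ℤ) ^ (((t ^ 2 + 1).primeFactors.filter (fun p : ℕ => p ≠ 2)).card +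
        if t % 4 < 2 then 0 else 1) := by
    split_ifs <;> ring
  rw [hF t ht, hrank, hrank', rhs_eq]
  apply neg_one_pow_congr
  simp only [h2iff]
  rcases Nat.even_or_odd' t with ⟨k, hk | hk⟩
  · -- `t` even: `ω_odd = ω`
    have hωe := hωeven (by omega)
    by_cases hβ : ∃ p ∈ (t ^ 2 + 1).primeFactors, p % 8 = 5
    · simp only [hβ, and_true, not_true_eq_false, and_false, if_false]
      split_ifs <;> omega
    · simp only [hβ, and_false, or_false, not_false_eq_true, and_true]
      split_ifs <;> omega
  · -- `t` odd: `ω_odd + 1 = ω`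
    have hωo := hωodd (by omega)
    by_cases hβ : ∃ p ∈ (t ^ 2 + 1).primeFactors, p % 8 = 5
    · simp only [hβ, and_true, not_true_eq_false, and_false, if_false]
      split_ifs <;> omega
    · simp only [hβ, and_false, or_false, not_false_eq_true, and_true]
      split_ifs <;> omega

end Summit.Parity.BatemanHorn.Theorems.PencilSelmerDictionary

end
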